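import Literature.NumberTheory.EllipticCurves.KellerYin2024.CharacterSelmerGroups
import Literature.NumberTheory.EllipticCurves.KatoFineSelmerDualMuProofs
import Literature.NumberTheory.EllipticCurves.IwasawaModuleFinitePadicIntProofs
import HarnessLib

/-!
# Route `CumulativeHeegnerLeopoldt`, crux K2 `EisensteinCharacterInvariantsAtThree` (stmt-BirchSwinnertonDyer-24199):
# GREENBERG'S CRITERION for ANY dual datum of `H¹_{𝓕_nr^{S₀}}(K_∞, M)` — residual finiteness ⟹ f.g., `Λ`-torsion,
# `μ = 0` (helper, `--supports 24199`; the torsion/`μ = 0` conjuncts of the line's stubs [BRram] and [BR𝟙])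

Lead prover `bsd-line-chl-p1` g9. The character-level stubs of the K2 line `birth` v3 (`stub_ramifiedBranch` [BRram],
`stub_charMainConjOnTree` [BR𝟙] = `X1.KellerYinMuLambdaSplit.CharMainConjOnTree 3`) conclude, for EVERY `Λ`-dual datum
`D : GreenbergVatsal2000.DatumDualData κ γ M_θ (Castella2018.AcSelmer.bdpData M_θ p v̄) S₀` of the unramified-at-`v̄`
Selmer group `H¹_{𝓕_nr^{S₀}}(K_∞, M_θ)` of a character module `M_θ = (F/𝒪)(θ)`, that `D.X` is finitely generated,
`Λ`-torsion, has `μ = 0`, AND an equality of `λ`-invariants. This file proves — for an ARBITRARY discrete `p`-primary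
`Γ_K`-module `M` with open stabilisers and an ARBITRARY dual datum `D` — that the first three conjuncts follow from
the RESIDUAL statement «`H¹_{𝓕_nr^{S₀}}(K_∞, M)[p]` is finite» (Greenberg, LNM 1716 §1 p. 60: `X/𝔪X` finite ⟹ `X`
f.g. by Nakayama; `X/(p)X` finite ⟹ torsion with `μ = 0`). It is the tree's
`WeierstrassCurve.GreenbergStrictSelmerDualData.finite_torsion_mu_of_finite_pTorsion` (curves, strict data) transplanted
to Keller–Yin's `unrSelmer κ M v̄ S₀` and Greenberg–Vatsal dual data: the datum is an `IwasawaDual.IsDualPair` for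
`ψ = conj_γ − 1` (local nilpotence = the tree's `KellerYin2024.isLocNil_conjUnr_sub_one`), then
`IsDualPair.module_finite`, `IwasawaDual.finite_quotient_pSmul_of_finite_pTorsion`,
`isTorsion_of_finite_quotient_augIdealP`, `muInvariant_eq_zero_of_finite_quotient_augIdealP`. So the torsion/`μ = 0`
part of [BRram] / [BR𝟙] is reduced to residual finiteness — for a NON-ANOMALOUS character the content of the route's
PRINT item 26897 (CGLS22 Prop. 14) up to the Kummer comparison `M_θ[𝔭] ≅ 𝔽(θ̄)`.
THEOREMS ONLY (no `def`, no `sorry`); imports no `Theses` module. BSD is not proved for any curve by any of this.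
References: [GreenbergLNM1716] §1 p. 60 (after Conj. 1.3); [GreenbergVatsal2000] §2 p. 17; [KellerYin2024] §1.2,
Thm. 1.2.2; [Washington1997] §13.2.
-/

set_option autoImplicit false
-- `…BirchSwinnertonDyer.BirchSwinnertonDyer.Theorems…` is the problem's mandated namespace (D-0017).
set_option linter.dupNamespace false

noncomputable section

open scoped Classical

universe u

namespace Summit.BirchSwinnertonDyer.BirchSwinnertonDyer.Theorems.EisensteinCharacterInvariantsAtThreeUnrSelmerDualMu

open NumberField IsDedekindDomain Field
  Literature.NumberTheory.EllipticCurves Literature.NumberTheory.EllipticCurves.GreenbergSelmer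
  Literature.NumberTheory.EllipticCurves.GreenbergVatsal2000 Literature.NumberTheory.EllipticCurves.KellerYin2024
  Literature.NumberTheory.EllipticCurves.IwasawaAlgebra Literature.NumberTheory.EllipticCurves.IwasawaModuleFinitePadicInt

variable {K : Type u} [Field K] [NumberField K] {p : ℕ} [Fact p.Prime] (κ : ZpExtension K p)
  {M : Type u} [AddCommGroup M] [DistribMulAction (absoluteGaloisGroup K) M] [TopologicalSpace M]
  [DiscreteTopology M] (vbar : HeightOneSpectrum (𝓞 K)) (S₀ : Set (HeightOneSpectrum (𝓞 K)))

/-- **Every dual datum of `H¹_{𝓕_nr^{S₀}}(K_∞, M)` is a dual pair for `ψ = conj_γ − 1`** (`M` `p`-primary with open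
stabilisers, `γ` a topological generator): the fields of `GreenbergVatsal2000.DatumDualData` plus the local nilpotence
`KellerYin2024.isLocNil_conjUnr_sub_one`. [cite: GreenbergLNM1716, §1 p. 60 (after Conj. 1.3)]
[cite: GreenbergVatsal2000, §2 p. 17] -/
theorem isDualPair_of_datumDualData (htor : ∀ m : M, ∃ k : ℕ, p ^ k • m = 0)
    (hstab : ∀ m : M, IsOpen (MulAction.stabilizer (absoluteGaloisGroup K) m : Set (absoluteGaloisGroup K)))
    {γ : absoluteGaloisGroup K} (hγ : κ.IsTopGenerator γ)
    (D : DatumDualData κ γ M (Castella2018.AcSelmer.bdpData M p vbar) S₀) :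
    IwasawaDual.IsDualPair p (conjUnr κ M vbar S₀ γ - 1) D.toDual where
  bijective := D.bijective
  T_smul x s := by
    rw [D.toDual_T_smul, IwasawaDual.End_sub_apply, AddMonoid.End.one_apply, map_sub]
    rfl
  C_smul c x s k hk := D.toDual_C_smul c x s k hk
  locNil := isLocNil_conjUnr_sub_one κ vbar S₀ htor hstab hγ

/-- **Greenberg's criterion for `H¹_{𝓕_nr^{S₀}}(K_∞, M)`: residual finiteness ⟹ every `Λ`-dual is finitely generated,
`Λ`-torsion and has `μ = 0`.** For a discrete `p`-primary `Γ_K`-module `M` with open stabilisers, a `ℤ_p`-extension `κ`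
with topological generator `γ`, a prime `v̄` and a set `S₀` of places: if `{s ∈ H¹_{𝓕_nr^{S₀}}(K_∞, M) | p·s = 0}` is
finite, then for EVERY dual datum `D` (`GreenbergVatsal2000.DatumDualData κ γ M (bdpData M p v̄) S₀`) the module `D.X`
is finitely generated over `Λ = ℤ_p⟦T⟧` (Nakayama for duals: `X/𝔪X` finite), `Λ`-torsion and `μ(D.X) = 0` (`X/(p)X`
finite). The shape `Module.Finite ∧ Module.IsTorsion ∧ muInvariant = 0` is exactly the first three conjuncts of the
K2 line's stubs [BRram] and [BR𝟙] (`X1.KellerYinMuLambdaSplit.CharMainConjOnTree`) for a character module.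
[cite: GreenbergLNM1716, §1 p. 60 (after Conj. 1.3)] [cite: Washington1997, §13.2] -/
theorem finite_torsion_mu_of_finite_pTorsion_unrSelmer (htor : ∀ m : M, ∃ k : ℕ, p ^ k • m = 0)
    (hstab : ∀ m : M, IsOpen (MulAction.stabilizer (absoluteGaloisGroup K) m : Set (absoluteGaloisGroup K)))
    {γ : absoluteGaloisGroup K} (hγ : κ.IsTopGenerator γ)
    (D : DatumDualData κ γ M (Castella2018.AcSelmer.bdpData M p vbar) S₀)
    (hfin : Set.Finite {s : unrSelmer κ M vbar S₀ | p • s = 0}) :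
    Module.Finite (IwasawaAlgebra p) D.X ∧ Module.IsTorsion (IwasawaAlgebra p) D.X ∧ muInvariant p D.X = 0 := by
  have hpair := isDualPair_of_datumDualData κ vbar S₀ htor hstab hγ D
  -- every Selmer class is `p`-primary
  have hStor : ∀ s : unrSelmer κ M vbar S₀, ∃ k : ℕ, p ^ k • s = 0 :=
    (isLocNil_conjUnr_sub_one κ vbar S₀ htor hstab hγ).torsion
  -- Nakayama: `X/𝔪X` finite (a fortiori from `S[p]` finite) ⟹ `X` finitely generated
  haveI hfg : Module.Finite (IwasawaAlgebra p) D.X := by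
    refine hpair.module_finite (hfin.subset fun s hs ↦ ?_)
    obtain ⟨hs1, -⟩ := hs
    rw [pow_one] at hs1
    exact hs1
  -- `X/(p)X` finite
  have hq : Finite (D.X ⧸ (IwasawaAlgebra.augIdealP p • (⊤ : Submodule (IwasawaAlgebra p) D.X))) :=
    IwasawaDual.finite_quotient_pSmul_of_finite_pTorsion D.bijective D.toDual_C_smul hStor hfin
  have hT : Module.IsTorsion (IwasawaAlgebra p) D.X := isTorsion_of_finite_quotient_augIdealP p D.X hq
  exact ⟨hfg, hT, muInvariant_eq_zero_of_finite_quotient_augIdealP p D.X hT hq⟩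

end Summit.BirchSwinnertonDyer.BirchSwinnertonDyer.Theorems.EisensteinCharacterInvariantsAtThreeUnrSelmerDualMu

end
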